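import Summits.RiemannHypothesis.RiemannHypothesis.Theorems.SpectralTraceWindowStepStubLogIntegrability
import Summits.RiemannHypothesis.RiemannHypothesis.Theorems.SpectralTraceWindowStepStubRealZeroDensityOfLogInt
import Summits.RiemannHypothesis.RiemannHypothesis.Theorems.SpectralTraceWindowStepStubGapLemma
import HarnessLib

/-!
# Sharp upper density `2a/π` of the real zeros of a Weil ground-state transform
# (crux `WindowStep`, line `split-birth`: the v1 stub `stub_realZeroDensity` as an importable theorem)

Support file for the crux `stmt-RiemannHypothesis-14659`
(`Summit.RiemannHypothesis.RiemannHypothesis.Theses.SpectralTrace.WindowStep`), line `split-birth`.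
The planner's v1 stub `stub_realZeroDensity` (Levinson–Cartwright for ground-state transforms) is
assembled from the two LANDED elementary stubs of skeleton v2 — `stub_logIntegrability` (p148782:
Poisson integrability of `log⁻|F|` for an entire `F` of exponential type bounded on `ℝ`) and
`stub_realZeroDensityOfLogInt` (p150385: averaged Jensen ⇒ real-zero density `≤ 2B/π`) — applied to
`F(z) = û(1/2 + iz)`, which is entire (`differentiable_weilMellin_half_add`), bounded by
`max 1 ‖u‖₁ · e^{a|Im z|}` (`norm_weilMellin_half_add_le`) and `≢ 0` on `ℝ`
(`exists_weilMellin_half_line_ne_zero`). Stated here as a `Theorems/` declaration so that other lines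
(WindowTraceArch, WindowTracePrime2, WeilWindowFlow) can import the SHARP slope `2a/π` in place of the
Jensen slope `2a/log 2` of `exists_card_real_zeros_le`.
-/

set_option linter.dupNamespace false

noncomputable section

open Complex Set Filter MeasureTheory

namespace Summit.RiemannHypothesis.RiemannHypothesis.Theorems.SpectralTraceWindowStep

open Literature.NumberTheory.LFunctions
open Summit.RiemannHypothesis.RiemannHypothesis.Theorems.WeilWindowFlowStrictUnderRH

/-- **Sharp upper density of the real zeros of a ground-state transform** (registered helper
`stub_realZeroDensity`, the v1 stub 4 of line `split-birth`): for a ground state `u` of the window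
`[-a, a]`, every finite set `Z` of real zeros of `x ↦ û(1/2 + ix)` in `[-r, r]` has
`#Z ≤ (2a/π + η) r` once `r ≥ r₀(u, η)` — the upper half of the Levinson–Cartwright theorem for the
Paley–Wiener function `û(1/2 + i·)`, by the elementary route `stub_logIntegrability` +
`stub_realZeroDensityOfLogInt`. [Boas 1954, Entire Functions, Thm 8.4.16 (upper half, real zeros)] -/
theorem stub_realZeroDensity : ∀ a : ℝ, 0 < a → ∀ u : ℝ → ℂ, Literature.NumberTheory.LFunctions.IsWeilGroundState a u → ∀ η : ℝ, 0 < η → ∃ r₀ : ℝ, ∀ r : ℝ, r₀ ≤ r → ∀ Z : Finset ℝ, (∀ x ∈ Z, |x| ≤ r ∧ Literature.NumberTheory.LFunctions.weilMellin u (1 / 2 + (x : ℂ) * Complex.I) = 0) → (Z.card : ℝ) ≤ (2 * a / Real.pi + η) * r := by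
  intro a ha u hu η hη
  have hF := differentiable_weilMellin_half_add hu
  have hb := norm_weilMellin_half_add_le hu
  obtain ⟨ξ, hξ⟩ := exists_weilMellin_half_line_ne_zero hu
  have hint := stub_logIntegrability (fun z : ℂ => weilMellin u (1 / 2 + z * Complex.I))
    (max 1 (∫ t, ‖u t‖)) a hF (le_max_left _ _) ha.le hb ⟨ξ, hξ⟩
  obtain ⟨r₀, hr₀⟩ := stub_realZeroDensityOfLogInt (fun z : ℂ => weilMellin u (1 / 2 + z * Complex.I))
    (max 1 (∫ t, ‖u t‖)) a hF (le_max_left _ _) ha.le hb ⟨ξ, hξ⟩ hint η hη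
  exact ⟨r₀, fun r hr Z hZ => hr₀ r hr Z hZ⟩

/-- The same, around an arbitrary real centre `c`: `#{real zeros with |x − c| ≤ r} ≤ (2a/π + η) r` for
`r ≥ r₀(u, c, η)` (apply `stub_realZeroDensity` with `η/2` on `[-(r + |c|), r + |c|]`). [folklore] -/
theorem card_real_zeros_near_le_sharp {a : ℝ} (ha : 0 < a) {u : ℝ → ℂ} (hu : IsWeilGroundState a u)
    (c : ℝ) {η : ℝ} (hη : 0 < η) :
    ∃ r₀ : ℝ, ∀ r : ℝ, r₀ ≤ r → ∀ Z : Finset ℝ,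
      (∀ x ∈ Z, |x - c| ≤ r ∧ weilMellin u (1 / 2 + (x : ℂ) * Complex.I) = 0) →
        (Z.card : ℝ) ≤ (2 * a / Real.pi + η) * r := by
  obtain ⟨r₁, hr₁⟩ := stub_realZeroDensity a ha u hu (η / 2) (by positivity)
  have hπ : 0 < 2 * a / Real.pi := by positivity
  refine ⟨max (max r₁ 1) ((2 * a / Real.pi + η / 2) * |c| * (2 / η)), fun r hr Z hZ => ?_⟩
  have hr1 : r₁ ≤ r + |c| :=
    (((le_max_left _ _).trans (le_max_left _ _)).trans hr).trans (by linarith [abs_nonneg c])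
  have hrc : (2 * a / Real.pi + η / 2) * |c| * (2 / η) ≤ r := (le_max_right _ _).trans hr
  have h := hr₁ (r + |c|) hr1 Z fun x hx => ⟨by
    have := (hZ x hx).1
    calc |x| = |x - c + c| := by ring_nf
      _ ≤ |x - c| + |c| := abs_add_le _ _
      _ ≤ r + |c| := by linarith, (hZ x hx).2⟩
  have hkey : (2 * a / Real.pi + η / 2) * |c| ≤ η / 2 * r := by
    rw [← div_le_iff₀' (by positivity : (0 : ℝ) < η / 2)] 
    calc (2 * a / Real.pi + η / 2) * |c| / (η / 2) = (2 * a / Real.pi + η / 2) * |c| * (2 / η) := by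
          field_simp
      _ ≤ r := hrc
  calc (Z.card : ℝ) ≤ (2 * a / Real.pi + η / 2) * (r + |c|) := h
    _ = (2 * a / Real.pi + η / 2) * r + (2 * a / Real.pi + η / 2) * |c| := by ring
    _ ≤ (2 * a / Real.pi + η / 2) * r + η / 2 * r := by linarith
    _ = (2 * a / Real.pi + η) * r := by ring

end Summit.RiemannHypothesis.RiemannHypothesis.Theorems.SpectralTraceWindowStep

end
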